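import Summits.Ventures.CertifiedManyBodySolver.HubbardAlg.GSWindowNodeD4
import Summits.Ventures.CertifiedManyBodySolver.Transport.D4VecAction
import Literature.MathematicalPhysics.QuantumLattice.InfVolFermionStateTorusLimitLocalStability
import Literature.MathematicalPhysics.QuantumLattice.InfVolFermionStateHubbardEnergy
import Literature.MathematicalPhysics.QuantumLattice.HubbardEnergyDensityVariationalPrinciple
import Literature.MathematicalPhysics.QuantumLattice.HubbardNNNHoppingCorrelatorCertificate
import HarnessLib

/-!
# Ventures/CertifiedManyBodySolver — HubbardAlg/GSWindowNodeD4Sound.lean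

HONEST FRAMING: ladder R1–R4 with certified numbers; no claim on H/H₀; bounds for model classes, no
materials claim.  (hubbard-alg: first certified bounds; not a superconductivity verdict; every number
certified or labelled float.  THIS FILE HAS NO NUMBER: it is the soundness proof of a relaxation node.)

**Soundness of the `D₄`-symmetrised ground-state window node** (`GSWindowNodeD4.GSWindowNodeSound`,
hubbard-alg L2 object R2, statement by l2-idea-1, `H1-STATEMENT.md` §3): for `U ≥ 0`, `0 ≤ n < 2`, every
window `W ⊆ ℤ²` and every energy observable `H ∈ 𝔄_W` (`IsEnergyObs`: `Re ω(H) = e(ω)` for all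
translation-invariant `ω`), a certified bound `GSWindowNode t U n W H lo` gives `lo ≤ e(t,U,n)`.

Proof (route (ii) of the `GSWindowNodeD4` docstring = op-07's `LTIRectGSNode.le_energyDensity2D` plus the
point group).  By `le_energyDensity2D_of_forall_torusLimit` it suffices to bound the energy density of
every state `ω` of the torus-limit ground-state class (translation invariant, even, density `n`, spin
densities `n/2`, torus limit of unit `(2⌊nL²/2⌋, S^z = 0)`-sector ground states).  §2: the image
`ω ∘ α_γ` of a state under the linear point-group map `x ↦ γx` (`d4Map`), with its translation
invariance, evenness and its one-site expectations; §3: the class is `D₄`-invariant — `ω ∘ α_γ` is the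
torus limit of the rotated family `D_{γ⁻¹} ψ_L` (`torusAvgExpectAt_d4Map`, reindexing the translation
average by `u ↦ γ⁻¹u`, as in `torusAvgExpectAt_shift`), again unit sector ground states
(`IsGroundStateInSector.fockD4_mulVec`); §4: the point-group average `ω̄ = 8⁻¹ Σ_γ ω ∘ α_γ` (`d4Avg`) is
translation invariant, even, `D₄`-invariant and agrees with `ω` on `𝔄_{{0}}`; §5: the window marginal
`ρ̄ = ω̄.rdm W` is feasible for every row of `GSWindowNode` — translation and affine-`D₄` rows by the
invariances, density / `S^z` rows at site `0`, the Bratteli–Robinson stability rows termwise by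
`IsTorusLimitOf.localStability` for each `ω ∘ α_γ` — and `Re Tr(ρ̄ H) = e(ω̄) = 8⁻¹ Σ_γ e(ω ∘ α_γ) = e(t,U,n)`
(`IsTorusLimitOf.hubbardEnergyDensity_eq_energyDensity2D` termwise).  Zero compute, no certificate, no new
definition of record (the two auxiliary state constructions `d4Map`, `d4Avg` are proof devices).  Namespace
`Summit.Ventures.CertifiedManyBodySolver.HubbardAlg.GSWindowNodeD4Sound` (sr-mbsolver D2 RULING r160 (e)); the theorem of
record is `GSWindowNodeD4Sound.gsWindowNodeSound : … → GSWindowNodeD4.GSWindowNodeSound t U n W H`.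

References: O. Bratteli, D. W. Robinson, *Operator Algebras and Quantum Statistical Mechanics 2*, 2nd ed.
(Springer 1997), §5.2.2 (quasi-local automorphisms), Prop. 5.3.25, §6.2.4; D. Ruelle, *Statistical
Mechanics: Rigorous Results* (1969) §3.4; D. J. Scalapino, Phys. Rep. 250 (1995) 329, §2 (point group `C₄ᵥ`).
-/

noncomputable section

namespace Summit.Ventures.CertifiedManyBodySolver.HubbardAlg.GSWindowNodeD4Sound

open Matrix Finset _root_.Filter Literature.Probability.LatticeModels Literature.MathematicalPhysics.QuantumLattice
  HubbardWave0 ThermodynamicLimit Summit.Ventures.CertifiedManyBodySolver.Transport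
  Summit.Ventures.CertifiedManyBodySolver.HubbardAlg.GSWindowNodeD4
open scoped _root_.Topology ComplexOrder

/-! ## §1 Transports of one local observable with equal site values have equal expectations -/

/-- Two transports `Γ(e₁) A ∈ 𝔄_{Λ₁}`, `Γ(e₂) A ∈ 𝔄_{Λ₂}` of one local observable `A ∈ 𝔄_S` along site
injections with the same underlying site map have the same expectation in every infinite-volume state
(compatibility along `Λ₁, Λ₂ ⊆ Λ₁ ∪ Λ₂` and functoriality of `Γ`). -/
theorem expect_fermionEmbed_eq_of_coe_eq (ω : InfVolFermionState 2) {S Λ₁ Λ₂ : Finset (Site 2)}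
    (e₁ : PolySite S ↪ PolySite Λ₁) (e₂ : PolySite S ↪ PolySite Λ₂)
    (h : ∀ y, ofLex (e₁ y).1 = ofLex (e₂ y).1) (A : FermionOp S) :
    ω.expect Λ₁ (fermionEmbed e₁ A) = ω.expect Λ₂ (fermionEmbed e₂ A) := by
  refine ω.expect_fermionEmbed_incl_eq subset_union_left subset_union_right _ _ ?_
  rw [fermionEmbed_fermionEmbed, fermionEmbed_fermionEmbed,
    fermionEmbed_congr (φ := e₁.trans (PolySite.incl subset_union_left))
      (ψ := e₂.trans (PolySite.incl subset_union_right)) fun y => Subtype.ext (congrArg toLex (h y))]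

/-! ## §2 The image of a state under the linear point-group maps `x ↦ γx` -/

/-- **The image `ω ∘ α_γ` of an infinite-volume state on `ℤ²` under the point-group map `x ↦ γ·x`**
(`γ ∈ D₄`): `(d4Map γ ω)_Λ(A) = ω_{γΛ}(Γ(α_γ) A)` with the regions `γΛ = d4ShiftSet γ 0 Λ` and the site
injections `PolySite.d4Emb γ 0 Λ` of `HubbardWindowCertificateD4`; again a state (compatibility by §1).
Bratteli–Robinson II §5.2.2 (quasi-local automorphisms of lattice symmetries). -/
def d4Map (γ : DihedralGroup 4) (ω : InfVolFermionState 2) : InfVolFermionState 2 where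
  expect Λ := ω.expect (d4ShiftSet γ 0 Λ) ∘ₗ (fermionEmbed (PolySite.d4Emb γ 0 Λ)).toLinearMap
  expect_one Λ := by
    rw [LinearMap.comp_apply, AlgHom.toLinearMap_apply, map_one, ω.expect_one]
  expect_nonneg Λ A := by
    rw [LinearMap.comp_apply, AlgHom.toLinearMap_apply, fermionEmbed_conjTranspose_mul_self]
    exact ω.expect_nonneg _ _
  compatible Λ Λ' hΛ A := by
    rw [LinearMap.comp_apply, AlgHom.toLinearMap_apply, LinearMap.comp_apply, AlgHom.toLinearMap_apply,
      fermionEmbed_fermionEmbed]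
    refine expect_fermionEmbed_eq_of_coe_eq ω _ _ (fun y => ?_) A
    rfl

/-- The local expectations of `ω ∘ α_γ` (definitional unfolding). -/
theorem d4Map_expect (γ : DihedralGroup 4) (ω : InfVolFermionState 2) (Λ : Finset (Site 2)) (A : FermionOp Λ) :
    (d4Map γ ω).expect Λ A = ω.expect (d4ShiftSet γ 0 Λ) (fermionEmbed (PolySite.d4Emb γ 0 Λ) A) := rfl

/-- `ω ∘ α_γ` is even when `ω` is (`Γ` commutes with the parity automorphism). -/
theorem isEven_d4Map {ω : InfVolFermionState 2} (hω : ω.IsEven) (γ : DihedralGroup 4) : (d4Map γ ω).IsEven :=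
  fun Λ A => by rw [d4Map_expect, d4Map_expect, fermionEmbed_parityAut, hω]

/-- `ω ∘ α_γ` is translation invariant when `ω` is: `α_γ ∘ τ_v = τ_{γv} ∘ α_γ` on sites (`d4Vec_add`). -/
theorem isTranslationInvariant_d4Map {ω : InfVolFermionState 2} (hω : ω.IsTranslationInvariant)
    (γ : DihedralGroup 4) : (d4Map γ ω).IsTranslationInvariant := by
  intro v
  refine InfVolFermionState.ext fun Λ => LinearMap.ext fun A => ?_
  rw [InfVolFermionState.shift_expect, d4Map_expect, d4Map_expect, fermionEmbed_fermionEmbed]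
  conv_rhs => rw [← hω (d4Vec γ v), InfVolFermionState.shift_expect, fermionEmbed_fermionEmbed]
  refine expect_fermionEmbed_eq_of_coe_eq ω _ _ (fun y => ?_) A
  simp only [Function.Embedding.trans_apply, PolySite.ofLex_coe_d4Emb, PolySite.ofLex_coe_shiftEmb, d4Vec_add,
    add_zero]

/-- `ω ∘ α_γ` agrees with `ω` on the one-site algebra `𝔄_{{0}}` (`γ·0 = 0`). -/
theorem d4Map_expect_singleton_zero (γ : DihedralGroup 4) (ω : InfVolFermionState 2)
    (A : FermionOp ({0} : Finset (Site 2))) : (d4Map γ ω).expect {0} A = ω.expect {0} A := by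
  rw [d4Map_expect]
  conv_rhs => rw [← fermionEmbed_refl_apply A]
  refine expect_fermionEmbed_eq_of_coe_eq ω _ _ (fun y => ?_) A
  have hy : ofLex y.1 = 0 := Finset.mem_singleton.1 (PolySite.ofLex_mem y)
  rw [PolySite.ofLex_coe_d4Emb, Function.Embedding.refl_apply, hy, (d4Vec_eq_zero_iff γ 0).2 rfl, add_zero]

/-- `ω ∘ α_γ` has the particle density of `ω`. -/
theorem density_d4Map (γ : DihedralGroup 4) (ω : InfVolFermionState 2) : (d4Map γ ω).density = ω.density := by
  show ((d4Map γ ω).expect {0} _).re = (ω.expect {0} _).re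
  rw [d4Map_expect_singleton_zero]

/-- Iterated images: `(ω ∘ α_{γ'}) ∘ α_γ = ω ∘ α_{γ'γ}` (`d4Vec_mul`). -/
theorem d4Map_d4Map (γ γ' : DihedralGroup 4) (ω : InfVolFermionState 2) :
    d4Map γ (d4Map γ' ω) = d4Map (γ' * γ) ω := by
  refine InfVolFermionState.ext fun Λ => LinearMap.ext fun A => ?_
  rw [d4Map_expect, d4Map_expect, d4Map_expect, fermionEmbed_fermionEmbed]
  refine expect_fermionEmbed_eq_of_coe_eq ω _ _ (fun y => ?_) A
  simp only [Function.Embedding.trans_apply, PolySite.ofLex_coe_d4Emb, d4Vec_mul, add_zero]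

/-! ## §3 The torus side: `ω ∘ α_γ` is the torus limit of the rotated family `D_{γ⁻¹} ψ` -/

/-- `x ↦ x mod L` vanishes at the origin. -/
theorem proj_zero_site (L : ℕ) : Torus.proj L (0 : Site 2) = 0 := by
  funext i
  simp [Torus.proj]

/-- Rotating a region about the origin does not change whether `x ↦ x mod L` is injective on it. -/
theorem injOn_proj_d4ShiftSet_zero_iff (L : ℕ) (γ : DihedralGroup 4) (Λ : Finset (Site 2)) :
    Set.InjOn (Torus.proj (d := 2) L) ↑(d4ShiftSet γ 0 Λ) ↔ Set.InjOn (Torus.proj (d := 2) L) ↑Λ := by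
  constructor
  · intro h x hx y hy hxy
    have hx' : d4Vec γ x + 0 ∈ (d4ShiftSet γ 0 Λ : Set (Site 2)) := d4Vec_add_mem_d4ShiftSet γ 0 hx
    have hy' : d4Vec γ y + 0 ∈ (d4ShiftSet γ 0 Λ : Set (Site 2)) := d4Vec_add_mem_d4ShiftSet γ 0 hy
    have key := h hx' hy' (by rw [add_zero, add_zero, Torus.proj_d4Vec, Torus.proj_d4Vec, hxy])
    exact d4Vec_injective γ (add_right_cancel key)
  · intro h x hx y hy hxy
    rw [Finset.mem_coe, d4ShiftSet, Finset.mem_map] at hx hy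
    obtain ⟨x₀, hx₀, rfl⟩ := hx
    obtain ⟨y₀, hy₀, rfl⟩ := hy
    simp only [Function.Embedding.coeFn_mk, add_zero, Torus.proj_d4Vec] at hxy ⊢
    rw [h hx₀ hy₀ (d4Site_injective γ hxy)]

section Torus

variable {L : ℕ} [NeZero L]

/-- (Local, as in `HubbardWindowCertificateD4`.) -/
local instance (priority := high) instDecidableEqFermionTorusSound : DecidableEq (FermionTorus 2 L) :=
  LinearOrder.toDecidableEq

/-- **Point-group covariance of the averaged torus expectations**: the rotated observable `Γ(α_γ) A`
on `γΛ` has, in `ψ`, the translation-averaged expectation of `A` on `Λ` in `D_{γ⁻¹} ψ`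
(`Γ(ι_{γΛ}) Γ(α_γ) A = D_γ (Γ(ι_Λ) A) D_γᴴ`, `D_γᴴ U_u = U_{γ⁻¹u} D_γᴴ`, reindex `u ↦ γ⁻¹ u`). -/
theorem torusAvgExpectAt_d4Map (γ : DihedralGroup 4) (Λ : Finset (Site 2)) (A : FermionOp Λ)
    (ψ : Fock (Orb (FermionTorus 2 L))) :
    torusAvgExpectAt L (d4ShiftSet γ 0 Λ) (fermionEmbed (PolySite.d4Emb γ 0 Λ) A) ψ =
      torusAvgExpectAt L Λ A ((fockD4 (L := L) γ⁻¹).val *ᵥ ψ) := by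
  by_cases h : Set.InjOn (Torus.proj (d := 2) L) ↑Λ
  · have h' : Set.InjOn (Torus.proj (d := 2) L) ↑(d4ShiftSet γ 0 Λ) :=
      (injOn_proj_d4ShiftSet_zero_iff L γ Λ).2 h
    rw [torusAvgExpectAt_of_injOn L h', torusAvgExpectAt_of_injOn L h, fermionEmbed_toTorusEmb_d4Emb γ 0 h h',
      proj_zero_site, Orb.translate_zero,
      show (1 : Equiv.Perm (Orb (FermionTorus 2 L))) = Equiv.refl _ from rfl, relabel_refl]
    refine congrArg (fun z : ℂ => ((Fintype.card (TorusSite 2 L) : ℂ))⁻¹ * z) ?_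
    set B := fermionEmbed (PolySite.toTorusEmb L h) A
    set φ := (fockD4 (L := L) γ⁻¹).val *ᵥ ψ with hφ
    have hstep : ∀ u : TorusSite 2 L,
        expect (relabel (Orb.d4Perm γ) B) ((fockTranslate u).val *ᵥ ψ) =
          expect B ((fockTranslate (d4Site γ⁻¹ u)).val *ᵥ φ) := by
      intro u
      have hc : fockD4 (L := L) γ * fockTranslate (d4Site γ⁻¹ u) = fockTranslate u * fockD4 (L := L) γ := by
        apply Subtype.ext
        have key := fockD4_val_mul_fockTranslate_val (L := L) γ (d4Site γ⁻¹ u)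
        rwa [d4Site_apply_inv] at key
      have hg : fockD4 (L := L) γ * fockTranslate (d4Site γ⁻¹ u) * fockD4 (L := L) γ⁻¹ = fockTranslate u := by
        rw [hc, mul_assoc, ← map_mul, mul_inv_cancel, map_one, mul_one]
      have hval : (fockTranslate u).val =
          (fockD4 (L := L) γ).val * (fockTranslate (d4Site γ⁻¹ u)).val * (fockD4 (L := L) γ⁻¹).val := by
        rw [← hg]
        rfl
      rw [hval, ← mulVec_mulVec, ← mulVec_mulVec]
      exact expect_relabel_fockRelabel_mulVec (Orb.d4Perm γ) B _
    simp_rw [hstep]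
    exact Fintype.sum_equiv (d4SitePerm γ⁻¹) _ _ fun u => rfl
  · have h' : ¬ Set.InjOn (Torus.proj (d := 2) L) ↑(d4ShiftSet γ 0 Λ) :=
      fun h' => h ((injOn_proj_d4ShiftSet_zero_iff L γ Λ).1 h')
    rw [torusAvgExpectAt_of_not_injOn L h', torusAvgExpectAt_of_not_injOn L h]

end Torus

/-- The rotated family `L ↦ D_γ ψ_L` of torus vectors (unchanged at the empty torus `L = 0`). -/
def d4Family (γ : DihedralGroup 4) (ψ : ∀ L, Fock (Orb (FermionTorus 2 L))) (L : ℕ) :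
    Fock (Orb (FermionTorus 2 L)) :=
  if hL : L = 0 then ψ L else by
    haveI : NeZero L := ⟨hL⟩
    exact (fockD4 (L := L) γ).val *ᵥ ψ L

/-- `d4Family` at a side `L ≠ 0`. -/
theorem d4Family_eq (γ : DihedralGroup 4) (ψ : ∀ L, Fock (Orb (FermionTorus 2 L))) (L : ℕ) [NeZero L] :
    d4Family γ ψ L = (fockD4 (L := L) γ).val *ᵥ ψ L := by
  rw [d4Family, dif_neg (NeZero.ne L)]

/-- `torusAvgExpectAt_d4Map` for arbitrary side. -/
theorem torusAvgExpect_d4Map (L : ℕ) (γ : DihedralGroup 4) (Λ : Finset (Site 2)) (A : FermionOp Λ)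
    (ψ : ∀ L, Fock (Orb (FermionTorus 2 L))) :
    torusAvgExpect L (d4ShiftSet γ 0 Λ) (fermionEmbed (PolySite.d4Emb γ 0 Λ) A) (ψ L) =
      torusAvgExpect L Λ A (d4Family γ⁻¹ ψ L) := by
  rcases Nat.eq_zero_or_pos L with rfl | hL
  · rw [torusAvgExpect_zero, torusAvgExpect_zero]
  · haveI : NeZero L := NeZero.of_pos hL
    rw [torusAvgExpect_eq, torusAvgExpect_eq, torusAvgExpectAt_d4Map, d4Family_eq]

/-- **The torus-limit class is point-group invariant (limit part)**: if `ω` is the torus limit of `ψ`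
along `Ls`, then `ω ∘ α_γ` is the torus limit of the rotated family `D_{γ⁻¹} ψ` along `Ls`. -/
theorem isTorusLimitOf_d4Map {ω : InfVolFermionState 2} {ψ : ∀ L, Fock (Orb (FermionTorus 2 L))} {Ls : ℕ → ℕ}
    (h : ω.IsTorusLimitOf ψ Ls) (γ : DihedralGroup 4) : (d4Map γ ω).IsTorusLimitOf (d4Family γ⁻¹ ψ) Ls := by
  intro Λ A
  rw [d4Map_expect]
  simp_rw [← torusAvgExpect_d4Map]
  exact h _ _

/-- The rotated family consists of unit vectors where `ψ` does. -/
theorem d4Family_norm (γ : DihedralGroup 4) (ψ : ∀ L, Fock (Orb (FermionTorus 2 L))) {Ls : ℕ → ℕ}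
    (h1 : ∀ j, star (ψ (Ls j)) ⬝ᵥ ψ (Ls j) = 1) (j : ℕ) :
    star (d4Family γ ψ (Ls j)) ⬝ᵥ d4Family γ ψ (Ls j) = 1 := by
  rcases Nat.eq_zero_or_pos (Ls j) with h0 | hL
  · rw [d4Family, dif_pos h0]
    exact h1 j
  · haveI : NeZero (Ls j) := NeZero.of_pos hL
    rw [d4Family_eq, fockD4_apply, star_fockRelabel_mulVec_dotProduct]
    exact h1 j

/-- The rotated family consists of sector ground states of the (point-group invariant) Hubbard tori
where `ψ` does (`IsGroundStateInSector.fockD4_mulVec`). -/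
theorem d4Family_isGroundStateInSector (γ : DihedralGroup 4) (ψ : ∀ L, Fock (Orb (FermionTorus 2 L)))
    {Ls : ℕ → ℕ} {t U : ℝ} {N : ℕ → ℕ} {M : ℕ → ℝ}
    (hgs : ∀ j, IsGroundStateInSector (hubbardTorus 2 (Ls j) t U) (N j) (M j) (ψ (Ls j))) (j : ℕ) :
    IsGroundStateInSector (hubbardTorus 2 (Ls j) t U) (N j) (M j) (d4Family γ ψ (Ls j)) := by
  rcases Nat.eq_zero_or_pos (Ls j) with h0 | hL
  · rw [d4Family, dif_pos h0]
    exact hgs j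
  · haveI : NeZero (Ls j) := NeZero.of_pos hL
    rw [d4Family_eq]
    exact (hgs j).fockD4_mulVec γ (relabel_d4Perm_hubbardTorus γ t U)

/-! ## §4 The point-group average `ω̄ = 8⁻¹ Σ_γ ω ∘ α_γ` -/

/-- `0 ≤ 8⁻¹` in `ℂ` (`ComplexOrder`). -/
theorem inv_eight_nonneg : (0 : ℂ) ≤ (8 : ℂ)⁻¹ := by
  rw [show (8 : ℂ)⁻¹ = ((8⁻¹ : ℝ) : ℂ) by norm_num]
  exact Complex.zero_le_real.2 (by norm_num)

/-- **The point-group average `ω̄ = 8⁻¹ Σ_{γ ∈ D₄} ω ∘ α_γ` of a state** (a convex combination of the eight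
images; Bratteli–Robinson I §4.3.1, averaging over a compact symmetry group). -/
def d4Avg (ω : InfVolFermionState 2) : InfVolFermionState 2 where
  expect Λ := (8 : ℂ)⁻¹ • ∑ γ : DihedralGroup 4, (d4Map γ ω).expect Λ
  expect_one Λ := by
    rw [LinearMap.smul_apply, LinearMap.sum_apply]
    simp only [InfVolFermionState.expect_one, Finset.sum_const, Finset.card_univ, DihedralGroup.card, nsmul_eq_mul,
      smul_eq_mul]
    norm_num
  expect_nonneg Λ A := by
    rw [LinearMap.smul_apply, LinearMap.sum_apply, smul_eq_mul]
    exact mul_nonneg inv_eight_nonneg (Finset.sum_nonneg fun γ _ => (d4Map γ ω).expect_nonneg Λ A)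
  compatible Λ Λ' h A := by
    rw [LinearMap.smul_apply, LinearMap.sum_apply, LinearMap.smul_apply, LinearMap.sum_apply]
    simp only [(d4Map _ ω).compatible h]

/-- The local expectations of `ω̄`. -/
theorem d4Avg_expect (ω : InfVolFermionState 2) (Λ : Finset (Site 2)) (A : FermionOp Λ) :
    (d4Avg ω).expect Λ A = (8 : ℂ)⁻¹ * ∑ γ : DihedralGroup 4, (d4Map γ ω).expect Λ A := by
  show ((8 : ℂ)⁻¹ • ∑ γ : DihedralGroup 4, (d4Map γ ω).expect Λ) A = _
  rw [LinearMap.smul_apply, LinearMap.sum_apply, smul_eq_mul]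

/-- `ω̄` is translation invariant when `ω` is. -/
theorem isTranslationInvariant_d4Avg {ω : InfVolFermionState 2} (hω : ω.IsTranslationInvariant) :
    (d4Avg ω).IsTranslationInvariant := by
  intro v
  refine InfVolFermionState.ext fun Λ => LinearMap.ext fun A => ?_
  rw [InfVolFermionState.shift_expect, d4Avg_expect, d4Avg_expect]
  refine congrArg _ (Finset.sum_congr rfl fun γ _ => ?_)
  rw [← InfVolFermionState.shift_expect, isTranslationInvariant_d4Map hω γ v]

/-- `ω̄` is even when `ω` is. -/
theorem isEven_d4Avg {ω : InfVolFermionState 2} (hω : ω.IsEven) : (d4Avg ω).IsEven := fun Λ A => by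
  rw [d4Avg_expect, d4Avg_expect]
  exact congrArg _ (Finset.sum_congr rfl fun γ _ => isEven_d4Map hω γ Λ A)

/-- `ω̄` agrees with `ω` on the one-site algebra `𝔄_{{0}}`. -/
theorem d4Avg_expect_singleton_zero (ω : InfVolFermionState 2) (A : FermionOp ({0} : Finset (Site 2))) :
    (d4Avg ω).expect {0} A = ω.expect {0} A := by
  rw [d4Avg_expect]
  simp only [d4Map_expect_singleton_zero, Finset.sum_const, Finset.card_univ, DihedralGroup.card, nsmul_eq_mul]
  push_cast
  ring

/-- `ω̄` has the particle density of `ω`. -/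
theorem density_d4Avg (ω : InfVolFermionState 2) : (d4Avg ω).density = ω.density := by
  show ((d4Avg ω).expect {0} _).re = (ω.expect {0} _).re
  rw [d4Avg_expect_singleton_zero]

/-- **`ω̄` is point-group invariant**: `ω̄ ∘ α_γ = ω̄` (reindex the average by `γ' ↦ γ'γ`). -/
theorem d4Map_d4Avg (γ : DihedralGroup 4) (ω : InfVolFermionState 2) : d4Map γ (d4Avg ω) = d4Avg ω := by
  refine InfVolFermionState.ext fun Λ => LinearMap.ext fun A => ?_
  rw [d4Map_expect, d4Avg_expect, d4Avg_expect]
  refine congrArg _ ?_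
  have h : ∀ γ' : DihedralGroup 4,
      (d4Map γ' ω).expect (d4ShiftSet γ 0 Λ) (fermionEmbed (PolySite.d4Emb γ 0 Λ) A) = (d4Map (γ' * γ) ω).expect Λ A :=
    fun γ' => by rw [← d4Map_d4Map]; rfl
  simp_rw [h]
  exact Fintype.sum_equiv (Equiv.mulRight γ) _ _ fun γ' => rfl

/-! ## §5 Soundness of the `D₄`-symmetrised ground-state window node -/

/-- The spin-resolved particle number of a window in a translation-invariant state (op-07's
`re_expect_sum_numberOp`, `RectMarginalNodes.lean` §6). -/
theorem expect_sum_numberOp {ω : InfVolFermionState 2} (hω : ω.IsTranslationInvariant) (W : Finset (Site 2))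
    (σ : Fin 2) :
    ω.expect W (∑ y : PolySite W, numberOp y σ) = (W.card : ℂ) * ω.expect {0} (nAt 0 (mem_singleton_self 0) σ) := by
  rw [map_sum]
  have hy : ∀ y : PolySite W, ω.expect W (numberOp y σ) = ω.expect {0} (nAt 0 (mem_singleton_self 0) σ) := by
    intro y
    have h1 : ({ofLex y.1} : Finset (Site 2)) ⊆ W := singleton_subset_iff.2 (PolySite.ofLex_mem y)
    have key : fermionEmbed (PolySite.incl h1) (nAt (ofLex y.1) (mem_singleton_self _) σ) = numberOp y σ := by
      simp only [nAt, fermionEmbed_numberOp, PolySite.incl_pt]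
      rfl
    rw [← key, ω.compatible h1, hω.expect_nAt]
  simp only [hy, Finset.sum_const, Finset.card_univ, nsmul_eq_mul, card_polySite]

/-- **R2 — SOUNDNESS of the `D₄`-symmetrised ground-state window node** (`GSWindowNodeSound`, hubbard-alg L2):
for `U ≥ 0`, `0 ≤ n < 2`, every window `W` and every energy observable `H ∈ 𝔄_W`, a certified
`GSWindowNode t U n W H lo` gives `lo ≤ e(t,U,n)`.  The window marginal `ρ̄ = ω̄_W` of the point-group average
`ω̄` of a torus-limit ground state `ω` is feasible for every row family and has objective value `e(ω̄) = e(t,U,n)`. -/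
theorem gsWindowNodeSound {t U n : ℝ} (hU : 0 ≤ U) (hn0 : 0 ≤ n) (hn2 : n < 2) (W : Finset (Site 2))
    (H : FermionOp W) : GSWindowNodeSound t U n W H := by
  intro hH lo hnode
  refine le_energyDensity2D_of_forall_torusLimit t hU hn0 hn2 fun ω ψ Ls hLs hω hti _ h1 hgs hd hspin => ?_
  -- the point-group average `ω̄ = d4Avg ω`: translation invariant, density `n`
  have hνti : (d4Avg ω).IsTranslationInvariant := isTranslationInvariant_d4Avg hti
  have hνd : (d4Avg ω).density = n := by rw [density_d4Avg, hd]
  -- every `ω ∘ α_γ` is in the class, hence carries the energy density `e(t,U,n)`; so do `ω` and `ω̄`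
  have hgsγ : ∀ γ : DihedralGroup 4, ∀ j,
      IsGroundStateInSector (hubbardTorus 2 (Ls j) t U) (rectN n (Ls j)) 0 (d4Family γ⁻¹ ψ (Ls j)) :=
    fun γ j => d4Family_isGroundStateInSector γ⁻¹ ψ hgs j
  have heγ : ∀ γ : DihedralGroup 4, (d4Map γ ω).hubbardEnergyDensity t U = energyDensity2D t U n := fun γ =>
    (isTorusLimitOf_d4Map hω γ).hubbardEnergyDensity_eq_energyDensity2D (t := t) hLs hU hn0 hn2 (hgsγ γ)
      (d4Family_norm γ⁻¹ ψ h1)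
  have heω : ω.hubbardEnergyDensity t U = energyDensity2D t U n :=
    hω.hubbardEnergyDensity_eq_energyDensity2D (t := t) hLs hU hn0 hn2 hgs h1
  have heν : (d4Avg ω).hubbardEnergyDensity t U = energyDensity2D t U n := by
    have hre : ∀ γ : DihedralGroup 4,
        ((d4Map γ ω).expect _ ((hubbardFermionInteraction 2 t U).meanEnergyObs 1)).re = energyDensity2D t U n := heγ
    show ((d4Avg ω).expect _ ((hubbardFermionInteraction 2 t U).meanEnergyObs 1)).re = _
    rw [d4Avg_expect, show (8 : ℂ)⁻¹ = ((8⁻¹ : ℝ) : ℂ) by norm_num, Complex.re_ofReal_mul, Complex.re_sum]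
    simp only [hre, Finset.sum_const, Finset.card_univ, DihedralGroup.card, nsmul_eq_mul]
    push_cast
    ring
  -- feasibility of the window marginal `ρ̄ = ω̄_W` for every row family of the node
  have key := hnode ((d4Avg ω).rdm W) ((d4Avg ω).rdm_posSemidef W) ((d4Avg ω).trace_rdm W)
    (fun S v hS hSv A => by
      rw [(d4Avg ω).trace_rdm_mul, (d4Avg ω).trace_rdm_mul, (d4Avg ω).compatible hS, ← fermionEmbed_fermionEmbed,
        (d4Avg ω).compatible hSv, ← InfVolFermionState.shift_expect, hνti v])
    (fun γ w S hS hS' A => by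
      rw [(d4Avg ω).trace_rdm_mul, (d4Avg ω).trace_rdm_mul, (d4Avg ω).compatible hS, (d4Avg ω).compatible hS',
        expect_fermionEmbed_eq_of_coe_eq (d4Avg ω) (PolySite.d4Emb γ w S)
          ((PolySite.d4Emb γ 0 S).trans (PolySite.shiftEmb w (d4ShiftSet γ 0 S)))
          (fun y => by
            simp only [Function.Embedding.trans_apply, PolySite.ofLex_coe_d4Emb, PolySite.ofLex_coe_shiftEmb,
              add_zero]) A,
        ← fermionEmbed_fermionEmbed, ← InfVolFermionState.shift_expect, hνti w, ← d4Map_expect, d4Map_d4Avg])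
    (by rw [(d4Avg ω).trace_rdm_mul, hνti.re_expect_totalNumber, hνd])
    (fun σ => by
      rw [(d4Avg ω).trace_rdm_mul, expect_sum_numberOp hνti, d4Avg_expect_singleton_zero, hspin σ,
        ← Complex.ofReal_natCast, ← Complex.ofReal_mul, Complex.ofReal_re])
    (fun Λ hΛ A hAN hAS => by
      rw [(d4Avg ω).trace_rdm_mul, (d4Avg ω).compatible hΛ, d4Avg_expect]
      exact mul_nonneg inv_eight_nonneg (Finset.sum_nonneg fun γ _ =>
        InfVolFermionState.IsTorusLimitOf.localStability t U (isTorusLimitOf_d4Map hω γ) hLs (hgsγ γ) hAN hAS))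
  rw [(d4Avg ω).trace_rdm_mul, hH (d4Avg ω) hνti, heν, ← heω] at key
  exact key

end Summit.Ventures.CertifiedManyBodySolver.HubbardAlg.GSWindowNodeD4Sound

end
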